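import Literature.Analysis.FunctionSpaces.HolderManifoldLaplacian
import Literature.Geometry.Lorentzian.HessianLocalMax
import HarnessLib

/-!
# The model operator `L₀ = Δ_g − 1` on `C^{k+2,r}_𝔄(M)`: boundedness and injectivity
# (Hölder spaces, part 16)

Topic `Literature/Analysis/FunctionSpaces`. On a compact manifold with Hölder chart data `𝔄`
(part 4) and a smooth metric `g`, the model operator of the method of continuity,
`L₀ u = Δ_g u − u`, is a bounded operator `C^{k+2,r}_𝔄(M, ℝ) →L[ℝ] C^{k,r}_𝔄(M, ℝ)`
(`modelOperatorCLM`; part 15 for `Δ_g = □_g`, plus the bounded inclusions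
`C^{k+2,r}_𝔄 ⊆ C^{k+1,r}_𝔄 ⊆ C^{k,r}_𝔄`, `HolderManifoldFunction.inclCLM`), and for positive
definite `g` it is **injective**: a solution of `Δ_g u = u` attains a nonnegative maximum where
`Δ_g u ≤ 0` and a nonpositive minimum where `Δ_g u ≥ 0` (`dalembertian_nonpos_of_isLocalMax`,
tree), so `u = 0` (`modelOperator_injective`; Gilbarg–Trudinger 2001, Thm. 3.1/Cor. 3.2, the weak
maximum principle with `c = −1 < 0`, on a closed manifold). With a global Schauder estimate and the
smooth solvability of `Δ_g u − u = f` (tree: `exists_smooth_solution_schrodinger_of_coercive`,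
`SchrodingerClosedManifold.lean`) this is the endpoint `L₀` of the continuity segment in item (2c)
of the census of `Literature.Geometry.Riemannian.gurskyViaclovsky_pathOpen_weighted_four`.
Everything is proved; no named facts.

## References

* D. Gilbarg, N. S. Trudinger, *Elliptic Partial Differential Equations of Second Order* (2001),
  Thm. 3.1, Cor. 3.2, §6.1. [GilbargTrudinger2001]
-/

noncomputable section

open Set Filter Topology Function
open scoped NNReal Manifold ContDiff

namespace Literature.Analysis.FunctionSpaces

open Literature.Geometry.Lorentzian

/-! ### Bounded inclusions `C^{k+1,r}_𝔄 ⊆ C^{k,r}_𝔄` -/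

namespace HolderManifoldFunction

variable {ι : Type*} [Fintype ι] {E : Type*} [NormedAddCommGroup E] [NormedSpace ℝ E]
  {M : Type*} [TopologicalSpace M] [ChartedSpace E M] {𝔄 : HolderChartData ι E M}
  {F : Type*} [NormedAddCommGroup F] [NormedSpace ℝ F] {k : ℕ} {r : ℝ≥0}

/-- The inclusion `C^{k+1,r}_𝔄 ⊆ C^{k,r}_𝔄` as a linear map (`r ≤ 1`). [folklore] -/
def inclₗ (hr : r ≤ 1) : HolderManifoldFunction 𝔄 F (k + 1) r →ₗ[ℝ] HolderManifoldFunction 𝔄 F k r where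
  toFun u := ⟨u, fun i => (u.memContDiffHolder_piece i).of_succ hr⟩
  map_add' _ _ := HolderManifoldFunction.ext fun _ => rfl
  map_smul' _ _ := HolderManifoldFunction.ext fun _ => rfl

/-- **The bounded inclusion `C^{k+1,r}_𝔄(M, F) →L[ℝ] C^{k,r}_𝔄(M, F)`** (closed graph). [folklore] -/
def inclCLM [CompleteSpace F] (hr : r ≤ 1) :
    HolderManifoldFunction 𝔄 F (k + 1) r →L[ℝ] HolderManifoldFunction 𝔄 F k r :=
  clmOfContinuousEval (inclₗ hr) fun x => continuous_eval x

/-- Pointwise: `inclCLM hr u x = u x`. [folklore] -/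
@[simp]
theorem inclCLM_apply [CompleteSpace F] (hr : r ≤ 1) (u : HolderManifoldFunction 𝔄 F (k + 1) r)
    (x : M) : inclCLM hr u x = u x := rfl

/-- The double inclusion `C^{k+2,r}_𝔄 →L[ℝ] C^{k,r}_𝔄`. [folklore] -/
def incl₂CLM [CompleteSpace F] (hr : r ≤ 1) :
    HolderManifoldFunction 𝔄 F (k + 2) r →L[ℝ] HolderManifoldFunction 𝔄 F k r :=
  (inclCLM (k := k) hr).comp (inclCLM (k := k + 1) hr)

/-- Pointwise: `incl₂CLM hr u x = u x`. [folklore] -/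
@[simp]
theorem incl₂CLM_apply [CompleteSpace F] (hr : r ≤ 1) (u : HolderManifoldFunction 𝔄 F (k + 2) r)
    (x : M) : incl₂CLM hr u x = u x := rfl

end HolderManifoldFunction

/-! ### The model operator -/

section Model

variable {ι : Type*} [Fintype ι] {E : Type} [NormedAddCommGroup E] [NormedSpace ℝ E]
  [FiniteDimensional ℝ E] {M : Type*} [TopologicalSpace M] [ChartedSpace E M]
  [IsManifold 𝓘(ℝ, E) ∞ M] [CompactSpace M] {k : ℕ} {r : ℝ≥0}

/-- **The model operator `L₀ u = Δ_g u − u`** as a bounded operator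
`C^{k+2,r}_𝔄(M, ℝ) →L[ℝ] C^{k,r}_𝔄(M, ℝ)`. [cite: GilbargTrudinger2001, §6.1] -/
def modelOperatorCLM (𝔄 : HolderChartData ι E M)
    (g : PseudoRiemannianMetric 𝓘(ℝ, E) ∞ E (TangentSpace 𝓘(ℝ, E) : M → Type _)) [g.HasLeviCivita]
    (hr : r ≤ 1) : HolderManifoldFunction 𝔄 ℝ (k + 2) r →L[ℝ] HolderManifoldFunction 𝔄 ℝ k r :=
  dalembertianCLM 𝔄 g hr - HolderManifoldFunction.incl₂CLM hr

/-- Pointwise: `modelOperatorCLM 𝔄 g hr u x = Δ_g u (x) − u x`. [folklore] -/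
@[simp]
theorem modelOperatorCLM_apply (𝔄 : HolderChartData ι E M)
    (g : PseudoRiemannianMetric 𝓘(ℝ, E) ∞ E (TangentSpace 𝓘(ℝ, E) : M → Type _)) [g.HasLeviCivita]
    (hr : r ≤ 1) (u : HolderManifoldFunction 𝔄 ℝ (k + 2) r) (x : M) :
    modelOperatorCLM 𝔄 g hr u x = g.dalembertian u x - u x := rfl

/-- **`L₀ = Δ_g − 1` is injective on `C^{k+2,r}_𝔄(M, ℝ)`** for positive definite `g`: a solution of
`Δ_g u = u` on the compact manifold has a nonnegative maximum (`Δ_g u ≤ 0` there) and a nonpositive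
minimum (`Δ_g u ≥ 0` there), hence vanishes. [cite: GilbargTrudinger2001, Thm. 3.1 and Cor. 3.2] -/
theorem modelOperator_injective (𝔄 : HolderChartData ι E M)
    (g : PseudoRiemannianMetric 𝓘(ℝ, E) ∞ E (TangentSpace 𝓘(ℝ, E) : M → Type _)) [g.HasLeviCivita]
    (hpos : ∀ (x : M) (v : TangentSpace 𝓘(ℝ, E) x), v ≠ 0 → 0 < g.val x v v) (hr : r ≤ 1) :
    Injective (modelOperatorCLM (k := k) 𝔄 g hr) := by
  refine (injective_iff_map_eq_zero _).2 fun u hu => ?_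
  have h0 : ∀ x, g.dalembertian u x - u x = 0 := fun x => by
    have h := congrArg (fun w : HolderManifoldFunction 𝔄 ℝ k r => w x) hu
    simpa using h
  refine HolderManifoldFunction.ext fun x => ?_
  obtain ⟨x₀, -, hmax⟩ :=
    isCompact_univ.exists_isMaxOn ⟨x, mem_univ x⟩ u.continuous.continuousOn
  obtain ⟨x₁, -, hmin⟩ :=
    isCompact_univ.exists_isMinOn ⟨x, mem_univ x⟩ u.continuous.continuousOn
  have h1 : g.dalembertian u x₀ ≤ 0 :=
    g.dalembertian_nonpos_of_isLocalMax (u.contMDiffAt_two x₀) (hmax.isLocalMax univ_mem) (hpos x₀)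
  have h2 : 0 ≤ g.dalembertian u x₁ :=
    g.dalembertian_nonneg_of_isLocalMin (u.contMDiffAt_two x₁) (hmin.isLocalMin univ_mem) (hpos x₁)
  have e0 := h0 x₀
  have e1 := h0 x₁
  have hle : u x ≤ u x₀ := hmax (mem_univ x)
  have hge : u x₁ ≤ u x := hmin (mem_univ x)
  show u x = (0 : HolderManifoldFunction 𝔄 ℝ (k + 2) r) x
  rw [HolderManifoldFunction.coe_zero, Pi.zero_apply]
  linarith

end Model

end Literature.Analysis.FunctionSpaces

end
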